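import Literature.NumberTheory.Automorphic.BCDTTheoremBWildAtThreeCases
import Literature.NumberTheory.GaloisRepresentations.TameInertiaGlobalCyclic
import Literature.NumberTheory.GaloisRepresentations.QuadraticInertia
import HarnessLib

/-!
# BCDT Theorem 2.2.1, cases 2–6: the quadratic twist is `ε₋₃` — the sign on inertia at `3` is `χ̄₃`

Topic `NumberTheory/Automorphic`; a theorems-only companion (no definitions, no named facts) of
`Literature.NumberTheory.Automorphic.BCDTTheoremBWildAtThree{,Det,Cases}`, landed by the tenured seat
of the named fact `Literature.NumberTheory.Automorphic.BCDT.theoremB` (Breuil–Conrad–Diamond–Taylor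
2001, Thm. B = Thm. 2.2.1) as a further bottom-up step INSIDE the wild case of its printed proof
(`exists_isTorsionGaloisRep_and_isModular_of_not_isTamelyRamifiedAbove`, BCDT §2.2, cases 2–6).

C. Breuil, B. Conrad, F. Diamond, R. Taylor, J. Amer. Math. Soc. 14 (2001) [BCDTJAMS2001], proof of
Theorem 2.2.1 (p. 860): *"Then up to equivalence and **twisting by a quadratic character**, one of
the following possibilities can be attained. … 2. `ρ̄|_{G₃}` is given by the character
`ℚ₃^× → 𝔽₅(τ)^×` determined by `3 ↦ τⁱ(τ - τ⁻¹)`, **`-1 ↦ 1`**, `4 ↦ τ` … 4.–6. … **`-1 ↦ -1`** …"*.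
The earlier files proved (Galois side, after a conjugation `f = xρ̄x⁻¹` at a prime `𝔓 ∣ 3`):
`f(wild inertia) = ⟨τ⟩` and `f(I_𝔓) ∈ {⟨τ⟩, ⟨τ, -1⟩, ⟨τ, σ⟩}`; the value "`-1 ↦ ±1`" of BCDT's cases
2–3 is the image of the tame inertia in `⟨τ, ±1⟩/⟨τ⟩`, and the printed normalisation "`-1 ↦ 1`"
is achieved by a quadratic twist.  This file identifies that twist on inertia: **the sign of
`f` on `I_𝔓` is the mod-`3` cyclotomic character `χ̄₃ = ε₋₃`** (the character of `ℚ(√-3) = ℚ(ζ₃)`),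
because the tame inertia group has a unique character of order `2`:

* `GaloisRepresentations.exists_mem_inertia_modPCyclotomicCharacterZMod_three_eq_neg_one` — **`χ̄₃`
  is ramified at `3`**: some `σ ∈ I_𝔓` (`𝔓 ∣ 3`) has `χ̄₃(σ) = -1` (it moves `√3`, by the tree's
  `exists_mem_inertia_smul_eq_neg_of_sq_eq_prime`, fixes `√-1` since `ℚ(√-1)` is unramified at `3`,
  hence sends `ζ₃ = (-1 + √3·√-1)/2` to `ζ₃²`);
* `zpow_mem_iff_even_of_sq_mem` — bookkeeping: `a ∉ S`, `a² ∈ S` ⇒ (`aᵏ ∈ S ⇔ k` even);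
* **`BCDT.apply_mem_zpowers_tau_iff_of_map_inertia_eq_closure_tau_neg_one`** — if
  `f(Γ_ℚ^u(𝔓)) ≤ ⟨τ⟩` for all `u > 0` and `f(I_𝔓) = ⟨τ, -1⟩` (cases 2–3 with "`-1 ↦ -1`"), then for
  `g ∈ I_𝔓`: **`f g ∈ ⟨τ⟩ ⇔ χ̄₃(g) = 1`** — so twisting `ρ̄` by `ε₋₃` (`= χ̄₃` read in `{±1} ⊂ 𝔽₅^×`)
  makes the inertia image `⟨τ⟩` ("`-1 ↦ 1`");
* **`BCDT.apply_mem_unitsF5Tau_iff_of_map_inertia_eq_closure_tau_sigma`** — if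
  `f(D_𝔓) ≤ N(𝔽₅(τ)^×)`, `f(Γ_ℚ^u(𝔓)) ≤ ⟨τ⟩` for `u > 0` and `f(I_𝔓) = ⟨τ, σ⟩` (cases 4–6), then for
  `g ∈ I_𝔓`: **`f g ∈ 𝔽₅(τ)^× ⇔ χ̄₃(g) = 1`** — the ramified quadratic field `M` cut out by
  `H = f⁻¹(𝔽₅(τ)^×)` has the same inertia subgroup as `ℚ₃(√-3)` (i.e. `M = ℚ₃(√±3)`);
* `BCDT.exists_conj_sign_of_not_isTamelyRamifiedAbove_three_of_det` — the assembled statement for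
  `ρ̄ : Γ_ℚ → GL₂(𝔽₅)` continuous with `det ρ̄ = χ̄₅`, not tamely ramified above `3`.

The proof of the two sign laws: by `TameInertiaGlobalCyclic` applied to `(f, χ̄₃)` there are
`s ∈ I_𝔓` and `u₀ > 0` with `(f g, χ̄₃ g) = (f w, χ̄₃ w)(f s, χ̄₃ s)ᵏ`, `w ∈ Γ^{u₀}(𝔓)`, for every
`g ∈ I_𝔓`; `f w ∈ ⟨τ⟩` and `χ̄₃ w = 1` (a `3`-group in `𝔽₃^×`), `f s ∉ ⟨τ⟩` resp. `∉ 𝔽₅(τ)^×` with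
`(f s)² ∈ ⟨τ⟩` resp. `∈ 𝔽₅(τ)^×`, and `χ̄₃ s = -1`; so both memberships hold iff `k` is even.

What is NOT done here: the twist of `ρ̄` itself (and the twist-invariance of modularity), and the
unramified sign of the Frobenius in case 2 (`f φ = ±ν`), which is a twist by an unramified-at-`3`
quadratic character not determined by the local data.

## References

* [BCDTJAMS2001] C. Breuil, B. Conrad, F. Diamond, R. Taylor, J. Amer. Math. Soc. 14 (2001),
  §2.2, proof of Thm. 2.2.1, p. 860 (cases 2–6: "up to … twisting by a quadratic character").
* [SerreLocalFields1979] J.-P. Serre, *Local Fields*, Ch. IV §2, Cor. 1 of Prop. 7 (`G_0/G_1`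
  cyclic); Ch. IV §4 (`ℚ_p(ζ_p)` totally ramified).
* [NeukirchANT1999] J. Neukirch, *Algebraic Number Theory*, Ch. I §9–§10 (ramification of `ℚ(√-1)`,
  `ℚ(√3)`, `ℚ(ζ₃)` at `3`).
-/

noncomputable section

open scoped NumberField Pointwise
open IsDedekindDomain Field

namespace Literature.NumberTheory.GaloisRepresentations

/-! ## Bookkeeping: `aᵏ ∈ S ⇔ k` even -/

/-- If `a ∉ S` but `a² ∈ S` for a subgroup `S`, then `aᵏ ∈ S` iff `k` is even. [folklore] -/
theorem zpow_mem_iff_even_of_sq_mem {G : Type*} [Group G] (S : Subgroup G) {a : G} (ha : a ∉ S)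
    (ha2 : a ^ 2 ∈ S) (k : ℤ) : a ^ k ∈ S ↔ Even k := by
  constructor
  · intro h
    by_contra hodd
    rw [Int.not_even_iff_odd] at hodd
    obtain ⟨m, rfl⟩ := hodd
    apply ha
    have h2m : a ^ (2 * m) ∈ S := by rw [zpow_mul]; exact Subgroup.zpow_mem _ (by exact_mod_cast ha2) m
    have : a = (a ^ (2 * m))⁻¹ * a ^ (2 * m + 1) := by rw [zpow_add, zpow_one]; group
    rw [this]
    exact mul_mem (inv_mem h2m) h
  · rintro ⟨m, rfl⟩
    rw [← two_mul, zpow_mul]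
    exact Subgroup.zpow_mem _ (by exact_mod_cast ha2) m

/-- If `b ∈ S`, `a ∉ S`, `a² ∈ S`, then `b aᵏ ∈ S` iff `k` is even. [folklore] -/
theorem mul_zpow_mem_iff_even_of_sq_mem {G : Type*} [Group G] (S : Subgroup G) {a b : G}
    (hb : b ∈ S) (ha : a ∉ S) (ha2 : a ^ 2 ∈ S) (k : ℤ) : b * a ^ k ∈ S ↔ Even k := by
  rw [← zpow_mem_iff_even_of_sq_mem S ha ha2 k]
  constructor
  · intro h
    have : a ^ k = b⁻¹ * (b * a ^ k) := by group
    rw [this]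
    exact mul_mem (inv_mem hb) h
  · exact fun h ↦ mul_mem hb h

/-- In `𝔽₃^× = {±1}`: `(-1)ᵏ = 1` iff `k` is even, and every unit is `±1`. [folklore] -/
theorem ZMod.neg_one_zpow_eq_one_iff_three (k : ℤ) : (-1 : (ZMod 3)ˣ) ^ k = 1 ↔ Even k := by
  have h := zpow_mem_iff_even_of_sq_mem (⊥ : Subgroup (ZMod 3)ˣ) (a := -1)
    (by rw [Subgroup.mem_bot]; decide) (by rw [Subgroup.mem_bot, neg_one_sq]) k
  rwa [Subgroup.mem_bot] at h

/-- The units of `𝔽₃` are `±1`. [folklore] -/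
theorem ZMod.units_three_eq_one_or (u : (ZMod 3)ˣ) : u = 1 ∨ u = -1 := by
  revert u; decide

/-! ## `χ̄₃` is ramified at `3` -/

/-- **The mod-`3` cyclotomic character is ramified at `3`**: for a prime `𝔓 ∣ 3` of `ℚ̄`, some
`σ ∈ I_𝔓 ≤ Γ_ℚ` has `χ̄₃(σ) = -1`, i.e. `σ ζ₃ = ζ₃²`.  Proof: by the tree's
`exists_mem_inertia_smul_eq_neg_of_sq_eq_prime` some `σ ∈ I_𝔓` has `σ √3 = -√3`; every `σ ∈ I_𝔓`
fixes `i = √-1` (`σ i = ±i`, and `σ i - i ∈ 𝔓` excludes `-i`: `(2i)² = -4` is a unit at `3`), so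
`σ` sends `ζ₃ = (-1 + √3 i)/2` to `(-1 - √3 i)/2 = ζ₃²` (the ramification of `ℚ(ζ₃) = ℚ(√-3)` at `3`).
[cite: NeukirchANT1999, Ch. I §10 (ramification in ℚ(ζ_n)) with §8–§9] -/
theorem exists_mem_inertia_modPCyclotomicCharacterZMod_three_eq_neg_one
    {v : HeightOneSpectrum (𝓞 ℚ)} (hv : ((3 : ℕ) : 𝓞 ℚ) ∈ v.asIdeal)
    {𝔓 : Ideal (absIntegers (𝓞 ℚ) ℚ)} (h𝔓 : 𝔓 ∈ v.primesAbove) :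
    ∃ σ ∈ 𝔓.inertia (absoluteGaloisGroup ℚ), modPCyclotomicCharacterZMod ℚ 3 σ = -1 := by
  haveI : 𝔓.IsPrime := h𝔓.1
  -- square roots of `3` and `-1` in `ℚ̄`
  obtain ⟨r, hr⟩ := IsAlgClosed.exists_eq_mul_self (3 : AlgebraicClosure ℚ)
  obtain ⟨i, hi⟩ := IsAlgClosed.exists_eq_mul_self (-1 : AlgebraicClosure ℚ)
  have hr2 : r ^ 2 = ((3 : ℕ) : AlgebraicClosure ℚ) := by rw [sq, ← hr]; norm_num
  have hi2 : i ^ 2 = -1 := by rw [sq, ← hi]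
  -- `σ ∈ I_𝔓` with `σ √3 = -√3`
  obtain ⟨σ, hσI, hσr⟩ := exists_mem_inertia_smul_eq_neg_of_sq_eq_prime Nat.prime_three hr2 hv h𝔓
  refine ⟨σ, hσI, ?_⟩
  -- `σ i = i`
  have hiint : IsIntegral (𝓞 ℚ) i := by
    refine IsIntegral.tower_top (R := ℤ) ?_
    refine ⟨Polynomial.X ^ 2 + 1, (Polynomial.monic_X_pow 2).add_of_left (by simp), ?_⟩
    simp [hi2]
  have hσi : σ • i = i := by
    have hsq : (σ • i) * (σ • i) = i * i := by
      rw [← smul_mul', ← sq, hi2, smul_neg, smul_one]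
    rcases mul_self_eq_mul_self_iff.mp hsq with h | h
    · exact h
    · exfalso
      -- `σ i - i = -2i ∈ 𝔓`, so `-(σ i - i)² - 3 = 4 - 3 = 1 ∈ 𝔓`
      set iI : absIntegers (𝓞 ℚ) ℚ := ⟨i, hiint⟩ with hiI
      have hmem : σ • iI - iI ∈ 𝔓 := hσI iI
      have hval : ((σ • iI - iI : absIntegers (𝓞 ℚ) ℚ) : AlgebraicClosure ℚ) = -2 * i := by
        rw [Subalgebra.coe_sub, integralClosure.coe_smul]
        change σ • i - i = -2 * i
        rw [h]; ring
      have h3mem : ((3 : ℕ) : absIntegers (𝓞 ℚ) ℚ) ∈ 𝔓 := by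
        have h1 : ((3 : ℕ) : 𝓞 ℚ) ∈ 𝔓.under (𝓞 ℚ) := by rw [← h𝔓.2.over]; exact hv
        rw [Ideal.under_def, Ideal.mem_comap, map_natCast] at h1
        exact h1
      have h1mem : (1 : absIntegers (𝓞 ℚ) ℚ) ∈ 𝔓 := by
        have e : (1 : absIntegers (𝓞 ℚ) ℚ) =
            -((σ • iI - iI) * (σ • iI - iI)) - ((3 : ℕ) : absIntegers (𝓞 ℚ) ℚ) := by
          apply Subtype.ext
          push_cast
          rw [integralClosure.coe_smul]
          change (1 : AlgebraicClosure ℚ) =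
            -((σ • i - i) * (σ • i - i)) - ((3 : ℕ) : AlgebraicClosure ℚ)
          rw [h]
          push_cast
          linear_combination (-4 : AlgebraicClosure ℚ) * hi
        rw [e]
        exact sub_mem (neg_mem (Ideal.mul_mem_left _ _ hmem)) h3mem
      exact Ideal.IsPrime.ne_top' ((Ideal.eq_top_iff_one 𝔓).mpr h1mem)
  -- `ζ₃ = (-1 + r i)/2` is a primitive cube root of unity with `σ ζ₃ = ζ₃²`
  set ζ : AlgebraicClosure ℚ := (-1 + r * i) * (2 : AlgebraicClosure ℚ)⁻¹ with hζdef
  have h2 : (2 : AlgebraicClosure ℚ) ≠ 0 := two_ne_zero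
  have hri : (r * i) * (r * i) = -3 := by
    rw [show (r * i) * (r * i) = (r * r) * (i * i) by ring, ← hr, ← hi]; norm_num
  have hζ2 : ζ ^ 2 = (-1 - r * i) * (2 : AlgebraicClosure ℚ)⁻¹ := by
    rw [hζdef]
    field_simp
    linear_combination hri
  have hζmin : ζ ^ 2 + ζ + 1 = 0 := by
    rw [hζ2, hζdef]
    field_simp
    ring
  have hζ3 : ζ ^ 3 = 1 := by
    have : ζ ^ 3 - 1 = (ζ - 1) * (ζ ^ 2 + ζ + 1) := by ring
    rw [← sub_eq_zero, this, hζmin, mul_zero]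
  have hζ1 : ζ ≠ 1 := by
    intro h
    rw [h] at hζmin
    norm_num at hζmin
  have hζprim : IsPrimitiveRoot ζ 3 := by
    refine IsPrimitiveRoot.mk_of_lt ζ (by norm_num) hζ3 fun l hl0 hl3 ↦ ?_
    interval_cases l
    · rwa [pow_one]
    · intro h
      apply hζ1
      calc ζ = ζ ^ 2 * ζ := by rw [h, one_mul]
        _ = ζ ^ 3 := by ring
        _ = 1 := hζ3
  have hσ2 : σ • (2 : AlgebraicClosure ℚ) = 2 := by
    rw [← one_add_one_eq_two, smul_add, smul_one]
  have hσζ : σ • ζ = ζ ^ 2 := by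
    rw [hζ2, hζdef, smul_mul', smul_inv'', hσ2, smul_add, smul_neg, smul_one, smul_mul', hσr, hσi,
      neg_mul, ← sub_eq_add_neg]
  -- read off `χ̄₃(σ) = 2 = -1`
  have hval : (modPCyclotomicCharacterZMod ℚ 3 σ : ZMod 3) = (2 : ℕ) := by
    rw [modPCyclotomicCharacterZMod_eq_modNCyclotomicCharacter]
    exact modNCyclotomicCharacter_eq_of_smul_eq_pow ℚ 3 hζprim σ hσζ
  ext
  rw [hval, Units.val_neg, Units.val_one]
  decide

end Literature.NumberTheory.GaloisRepresentations

namespace Literature.NumberTheory.GaloisRepresentations.GL2F5OrderThree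

/-- `-1 ∉ ⟨τ⟩` (the elements of `⟨τ⟩` are `1, τ, τ²`). [folklore] -/
theorem neg_one_not_mem_zpowers_tau : (-1 : GL (Fin 2) (ZMod 5)) ∉ Subgroup.zpowers tau := by
  rw [mem_zpowers_iff_of_orderOf_eq_three orderOf_tau]
  rintro (h | h | h)
  · exact absurd (congrArg enc h) (by rw [enc_neg, enc_one]; decide)
  · exact absurd (congrArg enc h) (by rw [enc_neg, enc_one, enc_tau]; decide)
  · exact absurd (congrArg enc h) (by rw [enc_neg, enc_one, tau_sq, enc_tau_inv]; decide)

/-- The square of an element of `⟨τ, -1⟩ = {±1, ±τ, ±τ²}` lies in `⟨τ⟩`. [folklore] -/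
theorem sq_mem_zpowers_tau_of_mem_closure_tau_neg_one {g : GL (Fin 2) (ZMod 5)}
    (hg : g ∈ Subgroup.closure ({tau, -1} : Set (GL (Fin 2) (ZMod 5)))) :
    g ^ 2 ∈ Subgroup.zpowers tau := by
  have hg' : g ∈ Subgroup.closure ({tau, sigma} : Set (GL (Fin 2) (ZMod 5))) := by
    refine (Subgroup.closure_le _).mpr ?_ hg
    intro u hu
    simp only [Set.mem_insert_iff, Set.mem_singleton_iff] at hu
    rcases hu with rfl | rfl
    · exact Subgroup.subset_closure (by simp)
    · exact neg_one_mem_closure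
  have ht : tau ∈ Subgroup.zpowers tau := Subgroup.mem_zpowers tau
  rcases mem_six_of_mem_closure_of_mem_unitsF5Tau hg' (closure_tau_neg_one_le_unitsF5Tau.1 hg) with
    rfl | rfl | rfl | rfl | rfl | rfl
  · rw [one_pow]; exact one_mem _
  · rw [neg_one_sq]; exact one_mem _
  · exact pow_mem ht 2
  · rw [neg_sq]; exact pow_mem ht 2
  · rw [← pow_mul]; exact pow_mem ht _
  · rw [neg_sq, ← pow_mul]; exact pow_mem ht _

end Literature.NumberTheory.GaloisRepresentations.GL2F5OrderThree

namespace Literature.NumberTheory.Automorphic.BCDT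

open Field GaloisRepresentations GaloisRepresentations.GL2F5OrderThree

/-! ## The sign of `ρ̄ˣ` on inertia at `3` is `χ̄₃` -/

section Sign

variable (ρ : ModPGaloisRep ℚ (ZMod 5) 2) (x : GL (Fin 2) (ZMod 5))
  {v : HeightOneSpectrum (𝓞 ℚ)} {𝔓 : Ideal (absIntegers (𝓞 ℚ) ℚ)}

/-- The value of `χ̄₃` on a wild ramification group `Γ_ℚ^u(𝔓)`, `u > 0`, `𝔓 ∣ 3`, is `1` (a `3`-group
mapping to `𝔽₃^×`, of order `2`). [folklore] -/
theorem modPCyclotomicCharacterZMod_three_eq_one_of_mem_absUpperRamificationSubgroup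
    (hv : ((3 : ℕ) : 𝓞 ℚ) ∈ v.asIdeal) (h𝔓 : 𝔓 ∈ v.primesAbove) {u : ℝ} (hu : 0 < u)
    {w : absoluteGaloisGroup ℚ} (hw : w ∈ absUpperRamificationSubgroup (𝓞 ℚ) 𝔓 u) :
    modPCyclotomicCharacterZMod ℚ 3 w = 1 := by
  set χ : absoluteGaloisGroup ℚ →ₜ* (ZMod 3)ˣ := modPCyclotomicCharacter ℚ (ZMod 3) 3 (RingHom.id _)
    with hχ
  have hχapply : ∀ g, χ g = modPCyclotomicCharacterZMod ℚ 3 g := fun g ↦ by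
    ext; rfl
  have hP := isPGroup_map_absUpperRamificationSubgroup h𝔓 hv hu χ
  obtain ⟨n, hn⟩ := hP ⟨χ w, ⟨w, hw, rfl⟩⟩
  have hn' : χ w ^ 3 ^ n = 1 := by
    have h := Subtype.ext_iff.mp hn
    rw [Subgroup.coe_pow, Subgroup.coe_one] at h
    exact h
  rw [← hχapply]
  rcases ZMod.units_three_eq_one_or (χ w) with h | h
  · exact h
  · exfalso
    rw [h, (Odd.pow (by decide : Odd 3)).neg_one_pow] at hn'
    exact absurd hn' (by decide)

/-- **A generator for the tame part of inertia, jointly for `ρ̄ˣ` and `χ̄₃`.**  If `ρ̄ˣ = xρ̄x⁻¹` maps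
every wild group `Γ_ℚ^u(𝔓)`, `u > 0` (`𝔓 ∣ 3`), into `⟨τ⟩`, then there is `s ∈ I_𝔓` such that every
`g ∈ I_𝔓` has `ρ̄ˣ(g) = t · ρ̄ˣ(s)ᵏ` and `χ̄₃(g) = χ̄₃(s)ᵏ` for some `k ∈ ℤ` and `t ∈ ⟨τ⟩` (the tame
inertia group is pro-cyclic: `TameInertiaGlobalCyclic`, applied to `(ρ̄ˣ, χ̄₃)`).
[cite: SerreLocalFields1979, Ch. IV §2 Cor. 1 of Prop. 7] -/
theorem exists_inertia_generator_conj_and_cyclotomic (hv : ((3 : ℕ) : 𝓞 ℚ) ∈ v.asIdeal)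
    (h𝔓 : 𝔓 ∈ v.primesAbove)
    (hwle : ∀ u : ℝ, 0 < u → ∀ σ ∈ absUpperRamificationSubgroup (𝓞 ℚ) 𝔓 u,
      x * ρ σ * x⁻¹ ∈ Subgroup.zpowers tau) :
    ∃ s ∈ 𝔓.inertia (absoluteGaloisGroup ℚ), ∀ g ∈ 𝔓.inertia (absoluteGaloisGroup ℚ),
      ∃ (k : ℤ) (t : GL (Fin 2) (ZMod 5)), t ∈ Subgroup.zpowers tau ∧
        x * ρ g * x⁻¹ = t * (x * ρ s * x⁻¹) ^ k ∧
        modPCyclotomicCharacterZMod ℚ 3 g = modPCyclotomicCharacterZMod ℚ 3 s ^ k := by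
  set cx : GL (Fin 2) (ZMod 5) →ₜ* GL (Fin 2) (ZMod 5) :=
    ⟨(MulAut.conj x).toMonoidHom, continuous_of_discreteTopology⟩ with hcx
  set f : absoluteGaloisGroup ℚ →ₜ* GL (Fin 2) (ZMod 5) := cx.comp ρ with hf
  have hfapply : ∀ g, f g = x * ρ g * x⁻¹ := fun g ↦ rfl
  set χ : absoluteGaloisGroup ℚ →ₜ* (ZMod 3)ˣ := modPCyclotomicCharacter ℚ (ZMod 3) 3 (RingHom.id _)
    with hχ
  have hχapply : ∀ g, χ g = modPCyclotomicCharacterZMod ℚ 3 g := fun g ↦ by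
    ext; rfl
  obtain ⟨s, hs, u₀, hu₀, hgen⟩ := exists_apply_inertia_eq_apply_wild_mul_zpow h𝔓 (f.prod χ)
  refine ⟨s, hs, fun g hg ↦ ?_⟩
  obtain ⟨k, w, hw, hgw⟩ := hgen g hg
  have h1 : f g = f w * f s ^ k := by
    have := congrArg Prod.fst hgw
    simpa using this
  have h2 : χ g = χ w * χ s ^ k := by
    have := congrArg Prod.snd hgw
    simpa using this
  have hχw : χ w = 1 := by
    rw [hχapply]
    exact modPCyclotomicCharacterZMod_three_eq_one_of_mem_absUpperRamificationSubgroup hv h𝔓 hu₀ hw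
  refine ⟨k, f w, hwle u₀ hu₀ w hw, ?_, ?_⟩
  · rw [← hfapply, ← hfapply, h1]
  · rw [← hχapply, ← hχapply, h2, hχw, one_mul]

/-- **Cases 2–3, "`-1 ↦ ±1`": the sign on inertia is `χ̄₃`.**  If `ρ̄ˣ` maps the wild groups at
`𝔓 ∣ 3` into `⟨τ⟩` and `ρ̄ˣ(I_𝔓) = ⟨τ, -1⟩`, then for every `g ∈ I_𝔓`:
`ρ̄ˣ(g) ∈ ⟨τ⟩ ⇔ χ̄₃(g) = 1`.  Hence the quadratic twist of BCDT's normalisation "`-1 ↦ 1`" is, on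
inertia, the twist by `ε₋₃ = χ̄₃` (the tame inertia group has a unique character of order `2`).
[cite: BCDTJAMS2001, §2.2 (proof of Thm. 2.2.1, p. 860: "twisting by a quadratic character", cases 2–3)] -/
theorem apply_mem_zpowers_tau_iff_of_map_inertia_eq_closure_tau_neg_one
    (hv : ((3 : ℕ) : 𝓞 ℚ) ∈ v.asIdeal) (h𝔓 : 𝔓 ∈ v.primesAbove)
    (hwle : ∀ u : ℝ, 0 < u → ∀ σ ∈ absUpperRamificationSubgroup (𝓞 ℚ) 𝔓 u,
      x * ρ σ * x⁻¹ ∈ Subgroup.zpowers tau)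
    (hI : (𝔓.inertia (absoluteGaloisGroup ℚ)).map ((MulAut.conj x).toMonoidHom.comp ρ.toMonoidHom) =
      Subgroup.closure {tau, -1})
    {g : absoluteGaloisGroup ℚ} (hg : g ∈ 𝔓.inertia (absoluteGaloisGroup ℚ)) :
    x * ρ g * x⁻¹ ∈ Subgroup.zpowers tau ↔ modPCyclotomicCharacterZMod ℚ 3 g = 1 := by
  obtain ⟨s, hs, hgen⟩ := exists_inertia_generator_conj_and_cyclotomic ρ x hv h𝔓 hwle
  -- `ρ̄ˣ(s) ∈ ⟨τ, -1⟩ ∖ ⟨τ⟩`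
  have hsI : x * ρ s * x⁻¹ ∈ Subgroup.closure ({tau, -1} : Set (GL (Fin 2) (ZMod 5))) := by
    rw [← hI]; exact ⟨s, hs, rfl⟩
  have hsτ : x * ρ s * x⁻¹ ∉ Subgroup.zpowers tau := by
    intro hsτ
    apply neg_one_not_mem_zpowers_tau
    have hle : Subgroup.closure ({tau, -1} : Set (GL (Fin 2) (ZMod 5))) ≤ Subgroup.zpowers tau := by
      rw [← hI]
      rintro _ ⟨g', hg', rfl⟩
      obtain ⟨k, t, ht, hgk, -⟩ := hgen g' hg'
      change x * ρ g' * x⁻¹ ∈ _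
      rw [hgk]
      exact mul_mem ht (Subgroup.zpow_mem _ hsτ k)
    exact hle (Subgroup.subset_closure (by simp))
  have hs2 : (x * ρ s * x⁻¹) ^ 2 ∈ Subgroup.zpowers tau :=
    sq_mem_zpowers_tau_of_mem_closure_tau_neg_one hsI
  -- `χ̄₃(s) = -1`
  have hχs : modPCyclotomicCharacterZMod ℚ 3 s = -1 := by
    obtain ⟨g₁, hg₁, hχg₁⟩ := exists_mem_inertia_modPCyclotomicCharacterZMod_three_eq_neg_one hv h𝔓
    obtain ⟨k₁, -, -, -, hk₁⟩ := hgen g₁ hg₁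
    rcases ZMod.units_three_eq_one_or (modPCyclotomicCharacterZMod ℚ 3 s) with h | h
    · rw [h, one_zpow] at hk₁
      exact absurd (hχg₁.symm.trans hk₁) (by decide)
    · exact h
  -- read off the parity of `k`
  obtain ⟨k, t, ht, hgk, hχk⟩ := hgen g hg
  rw [hgk, hχk, hχs, mul_zpow_mem_iff_even_of_sq_mem _ ht hsτ hs2,
    ZMod.neg_one_zpow_eq_one_iff_three]

/-- **Cases 4–6: the ramified quadratic field is `ℚ₃(√±3)`.**  If `ρ̄ˣ(D_𝔓) ≤ N(𝔽₅(τ)^×)`, `ρ̄ˣ`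
maps the wild groups at `𝔓 ∣ 3` into `⟨τ⟩` and `ρ̄ˣ(I_𝔓) = ⟨τ, σ⟩`, then for every `g ∈ I_𝔓`:
`ρ̄ˣ(g) ∈ 𝔽₅(τ)^× ⇔ χ̄₃(g) = 1`, i.e. the index-`2` subgroup `H = ρ̄ˣ⁻¹(𝔽₅(τ)^×)` meets `I_𝔓` in
`I_𝔓 ∩ ker χ̄₃`, the inertia subgroup of `ℚ₃(ζ₃) = ℚ₃(√-3)` ("`-1 ↦ -1`").
[cite: BCDTJAMS2001, §2.2 (proof of Thm. 2.2.1, p. 860, cases 4–6)] -/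
theorem apply_mem_unitsF5Tau_iff_of_map_inertia_eq_closure_tau_sigma
    (hv : ((3 : ℕ) : 𝓞 ℚ) ∈ v.asIdeal) (h𝔓 : 𝔓 ∈ v.primesAbove)
    (hN : ∀ σ ∈ 𝔓.decompositionSubgroup (absoluteGaloisGroup ℚ),
      x * ρ σ * x⁻¹ ∈ Subgroup.normalizer (unitsF5Tau : Set (GL (Fin 2) (ZMod 5))))
    (hwle : ∀ u : ℝ, 0 < u → ∀ σ ∈ absUpperRamificationSubgroup (𝓞 ℚ) 𝔓 u,
      x * ρ σ * x⁻¹ ∈ Subgroup.zpowers tau)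
    (hI : (𝔓.inertia (absoluteGaloisGroup ℚ)).map ((MulAut.conj x).toMonoidHom.comp ρ.toMonoidHom) =
      Subgroup.closure {tau, sigma})
    {g : absoluteGaloisGroup ℚ} (hg : g ∈ 𝔓.inertia (absoluteGaloisGroup ℚ)) :
    x * ρ g * x⁻¹ ∈ unitsF5Tau ↔ modPCyclotomicCharacterZMod ℚ 3 g = 1 := by
  obtain ⟨s, hs, hgen⟩ := exists_inertia_generator_conj_and_cyclotomic ρ x hv h𝔓 hwle
  have hsD : s ∈ 𝔓.decompositionSubgroup (absoluteGaloisGroup ℚ) :=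
    Ideal.inertia_le_decompositionSubgroup _ _ hs
  -- `ρ̄ˣ(s) ∈ N(C) ∖ C`
  have hsC : x * ρ s * x⁻¹ ∉ unitsF5Tau := by
    intro hsC
    apply closure_tau_neg_one_le_unitsF5Tau.2
    rw [← hI]
    rintro _ ⟨g', hg', rfl⟩
    obtain ⟨k, t, ht, hgk, -⟩ := hgen g' hg'
    change x * ρ g' * x⁻¹ ∈ _
    rw [hgk]
    exact mul_mem (zpowers_tau_le_unitsF5Tau ht) (Subgroup.zpow_mem _ hsC k)
  have hs2 : (x * ρ s * x⁻¹) ^ 2 ∈ unitsF5Tau := by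
    rw [pow_two]
    exact mul_mem_unitsF5Tau_of_not_mem_of_not_mem (hN s hsD) (hN s hsD) hsC hsC
  -- `χ̄₃(s) = -1`
  have hχs : modPCyclotomicCharacterZMod ℚ 3 s = -1 := by
    obtain ⟨g₁, hg₁, hχg₁⟩ := exists_mem_inertia_modPCyclotomicCharacterZMod_three_eq_neg_one hv h𝔓
    obtain ⟨k₁, -, -, -, hk₁⟩ := hgen g₁ hg₁
    rcases ZMod.units_three_eq_one_or (modPCyclotomicCharacterZMod ℚ 3 s) with h | h
    · rw [h, one_zpow] at hk₁
      exact absurd (hχg₁.symm.trans hk₁) (by decide)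
    · exact h
  obtain ⟨k, t, ht, hgk, hχk⟩ := hgen g hg
  rw [hgk, hχk, hχs, mul_zpow_mem_iff_even_of_sq_mem _ (zpowers_tau_le_unitsF5Tau ht) hsC hs2,
    ZMod.neg_one_zpow_eq_one_iff_three]

end Sign

/-- **BCDT, proof of Theorem 2.2.1, cases 2–6: "twisting by a quadratic character" is twisting by
`ε₋₃` (on inertia).**  Let `ρ̄ : Γ_ℚ → GL₂(𝔽₅)` be continuous with `det ρ̄ = χ̄₅` and NOT tamely ramified
above `3`.  Then at some `𝔓 ∣ 3`, after a conjugation `ρ̄ˣ = xρ̄x⁻¹`: `ρ̄ˣ(D_𝔓) ≤ N(𝔽₅(τ)^×)`, the wild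
groups map into `⟨τ⟩` (onto for some `u > 0`), `χ̄₃` takes the value `-1` on `I_𝔓`, and
* either `ρ̄ˣ(I_𝔓) = ⟨τ⟩` (cases 2–3, already "`-1 ↦ 1`"),
* or `ρ̄ˣ(I_𝔓) = ⟨τ, -1⟩` and **`ρ̄ˣ(g) ∈ ⟨τ⟩ ⇔ χ̄₃(g) = 1` on `I_𝔓`** (cases 2–3 with "`-1 ↦ -1`":
  the twist by `ε₋₃` restores "`-1 ↦ 1`"),
* or `ρ̄ˣ(I_𝔓) = ⟨τ, σ⟩` and **`ρ̄ˣ(g) ∈ 𝔽₅(τ)^× ⇔ χ̄₃(g) = 1` on `I_𝔓`** (cases 4–6: the quadratic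
  field on which `ρ̄` is a character has the inertia of `ℚ₃(√-3)`, i.e. is `ℚ₃(√±3)`).
[cite: BCDTJAMS2001, §2.2 (proof of Thm. 2.2.1, p. 860, cases 2–6)] -/
theorem exists_conj_sign_of_not_isTamelyRamifiedAbove_three_of_det (ρ : ModPGaloisRep ℚ (ZMod 5) 2)
    (hdet : ∀ σ : absoluteGaloisGroup ℚ,
      Matrix.GeneralLinearGroup.det (ρ σ) = modPCyclotomicCharacterZMod ℚ 5 σ)
    (hwild : ¬ ρ.IsTamelyRamifiedAbove 3) :
    ∃ v : HeightOneSpectrum (𝓞 ℚ), ((3 : ℕ) : 𝓞 ℚ) ∈ v.asIdeal ∧ ∃ 𝔓 ∈ v.primesAbove,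
      ∃ x : GL (Fin 2) (ZMod 5),
        (∀ σ ∈ 𝔓.decompositionSubgroup (absoluteGaloisGroup ℚ),
            x * ρ σ * x⁻¹ ∈ Subgroup.normalizer (unitsF5Tau : Set (GL (Fin 2) (ZMod 5)))) ∧
        (∀ u : ℝ, 0 < u → ∀ σ ∈ absUpperRamificationSubgroup (𝓞 ℚ) 𝔓 u,
            x * ρ σ * x⁻¹ ∈ Subgroup.zpowers tau) ∧
        (∃ u : ℝ, 0 < u ∧
          (absUpperRamificationSubgroup (𝓞 ℚ) 𝔓 u).map
              ((MulAut.conj x).toMonoidHom.comp ρ.toMonoidHom) = Subgroup.zpowers tau) ∧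
        (∃ g ∈ 𝔓.inertia (absoluteGaloisGroup ℚ), modPCyclotomicCharacterZMod ℚ 3 g = -1) ∧
        ((𝔓.inertia (absoluteGaloisGroup ℚ)).map ((MulAut.conj x).toMonoidHom.comp ρ.toMonoidHom) =
              Subgroup.zpowers tau ∨
          ((𝔓.inertia (absoluteGaloisGroup ℚ)).map ((MulAut.conj x).toMonoidHom.comp ρ.toMonoidHom) =
              Subgroup.closure {tau, -1} ∧
            ∀ g ∈ 𝔓.inertia (absoluteGaloisGroup ℚ),
              (x * ρ g * x⁻¹ ∈ Subgroup.zpowers tau ↔ modPCyclotomicCharacterZMod ℚ 3 g = 1)) ∨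
          ((𝔓.inertia (absoluteGaloisGroup ℚ)).map ((MulAut.conj x).toMonoidHom.comp ρ.toMonoidHom) =
              Subgroup.closure {tau, sigma} ∧
            ∀ g ∈ 𝔓.inertia (absoluteGaloisGroup ℚ),
              (x * ρ g * x⁻¹ ∈ unitsF5Tau ↔ modPCyclotomicCharacterZMod ℚ 3 g = 1))) := by
  obtain ⟨v, hv, 𝔓, h𝔓, x, hN, -, -, hwle, hwild', -, -, htri⟩ :=
    exists_conj_of_not_isTamelyRamifiedAbove_three_of_det ρ hdet hwild
  refine ⟨v, hv, 𝔓, h𝔓, x, hN, hwle, hwild',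
    exists_mem_inertia_modPCyclotomicCharacterZMod_three_eq_neg_one hv h𝔓, ?_⟩
  rcases htri with h | h | h
  · exact Or.inl h
  · exact Or.inr (Or.inl ⟨h, fun g hg ↦
      apply_mem_zpowers_tau_iff_of_map_inertia_eq_closure_tau_neg_one ρ x hv h𝔓 hwle h hg⟩)
  · exact Or.inr (Or.inr ⟨h, fun g hg ↦
      apply_mem_unitsF5Tau_iff_of_map_inertia_eq_closure_tau_sigma ρ x hv h𝔓 hN hwle h hg⟩)

end Literature.NumberTheory.Automorphic.BCDT

end
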